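import Literature.NumberTheory.Automorphic.Liu2021.LemD1Item3AtVOfSeparation
import Literature.RepresentationTheory.MoeglinVignerasWaldspurger1987.RankOneThetaLiftNonsplitSeparation
import Literature.NumberTheory.GelbartRogawski1991.LocalLineModelTransport
import Literature.RepresentationTheory.MoeglinVignerasWaldspurger1987.RankOneThetaLiftNonvanishingProofs
import HarnessLib

/-!
# [Liu2021, Lem. D.1 (3)] AT A FINITE PLACE on the indexed family `localIndexedFamilyAtV`: the `μ`-clause (→) at a
# NON-SPLIT place from the separation and twist rigidity of rank-one theta lifts, through a line-model transport — THEOREMS ONLY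

Topic `NumberTheory/Automorphic/Liu2021`; namespace `Literature.NumberTheory.Automorphic.Liu2021.Def411WeilCarriers` (the indexed
family `localIndexedFamilyAtV … v` of `Def411WeilCarriersLocalDataAtV.lean`).  The NON-SPLIT `μ`-twin of
`LemD1Item3AtVSplitOfSeparation.lean` §2 and the `μ`-companion of `LemD1Item3AtVOfSeparation.lean` §3 (the `(ε, χ)`-clauses),
in the same transport currency `(s_t, M_t)`.  KERNEL ONLY: theorems, no definition, no named fact, no `sorry`, debt Δ 0; rows
IV-4c1 `rankOne_theta_lines_disjoint` and IV-4c3 `rankOne_theta_twist_rigidity` (D-0014) enter as the HYPOTHESES `h1`, `h3`; the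
analytic inputs in the family's own currency are
* `hnt` — NON-VANISHING of the rank-one theta lift of member `i` (`Θ_{s_i}(χ_{i,v}) ≠ 0`, read at the centre line `(a_j)`; at a
  non-split place and rank `3` this is MVW IV.2, `mvw_IV2_rankOne_nonvanishing_of_isotropic_holds`, supplied by the `_of_facts`
  instantiation);
* `hK` — «TRANSPORTED-EQUAL SPLITTINGS ⇒ EQUAL `μ_v`» (Kudla's sections determine `μ_v`: `GelbartRogawski1991/LocalKudlaSplittingInjective`
  + the naturality of the `χ`-attached sections under the line isometry), as in the split twin.

* **`mu_eq_of_areIsomorphicRep_nonsplit_of_modelTransport`** — `N = 3`, `E_v` a field: under `h1`, `h3`, `hnt`, `hK`, transports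
  `(s_t, M_t)` with `ω_{s_t}` smooth, `AreIsomorphicRep (quot j) (quot i) → mu j = mu i`.  Proof: both members in the δ-model
  currency (`areIsomorphicRep_theta_comp_uEquiv_quot`), then `rankOne_theta_nonsplit_exists_lineTransportSplitting_eq_of_areIsomorphicRep`
  (IV-4c1: one class; IV-4c3 on the line `(a_j)` after `RankOneThetaLiftLinesEquivalent`'s transport) yields the antecedent of `hK`.

Written for the cell `hodgecm-mathlib`, fan A line `a4-liuD3`, stub `stub_mu_of_iso_nonsplit` (:190, `MuOfIsoNonsplit`: at `IsField`,
`Θ_j ≅ Θ_i → μ_j = μ_i`, v2 text with the fact binders `c1 → c3 → …`).  HC_CM is proved only modulo the 7 printed citations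
(`hDel`, `h21`, `hLiu418`, `h411`, `h413`, `hD3`, `hD1''`) until rung 0 closes; this file discharges none of them and no interface fact.

## References
* [Liu2021] Y. Liu, Camb. J. Math. 9 (2021) = arXiv:2102.11518 — App. D Lemma D.1 (3) (l. 5233) and its proof (l. 5255).
* [MoeglinVignerasWaldspurger1987] C. Mœglin, M.-F. Vignéras, J.-L. Waldspurger, LNM 1291, Chap. 2 II.1, Chap. 3 I.1–I.3, IV.
* [Kudla1994] S. Kudla, Israel J. Math. 87 (1994), Thm. 3.1 (explicit splittings).
-/

set_option autoImplicit false

noncomputable section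

open scoped Matrix Kronecker
open NumberField IsDedekindDomain
open _root_.MeasureTheory
open Literature.NumberTheory.Automorphic Literature.NumberTheory.Automorphic.UnitaryGroup
open Literature.RepresentationTheory
open Literature.RepresentationTheory.HeisenbergGroup (MpPsi)
open Literature.NumberTheory.GelbartRogawski1991 Literature.NumberTheory.GelbartRogawski1991.UnitaryDualPair
open Literature.NumberTheory.GelbartRogawski1991.UnitaryDualPair.WeilCoinv
open Literature.NumberTheory.GelbartRogawski1991.UnitaryDualPair.LocalSplitting
open Literature.RepresentationTheory.MoeglinVignerasWaldspurger1987

namespace Literature.NumberTheory.Automorphic.Liu2021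

namespace Def411WeilCarriers

variable (F E : Type) [Field F] [NumberField F] [Field E] [NumberField E] [Algebra F E]
variable (c : E ≃ₐ[F] E) (N : ℕ) {n : ℕ} (e : Fin N × Fin 1 ≃ Fin n)
variable (JV : Matrix (Fin N) (Fin N) E) {TV : Matrix (Fin N) (Fin N) F}
variable [Algebra.IsQuadraticExtension F E] {δ : E} (hcδ : c δ = -δ) (hδ : δ ≠ 0) {d : F} (hd : δ * δ = algebraMap F E d)

omit [NumberField F] [NumberField E] [Algebra.IsQuadraticExtension F E] in
/-- `2 ≤ N` when `3 ≤ n` (`N = n` along `e`; plumbing). [folklore] -/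
private theorem two_le_rank₃'' (e : Fin N × Fin 1 ≃ Fin n) (hn : 3 ≤ n) : 2 ≤ N := by
  have := Fintype.card_congr e; simp only [Fintype.card_prod, Fintype.card_fin, mul_one] at this; omega


section Three

variable {n : ℕ} (e : Fin 3 × Fin 1 ≃ Fin n) (JV : Matrix (Fin 3) (Fin 3) E) {TV : Matrix (Fin 3) (Fin 3) F}

/-- **[Liu2021, App. D Lem. D.1 (3)], `μ`-CLAUSE (→) AT A NON-SPLIT PLACE on `localIndexedFamilyAtV … v`, through a line-model
transport**, CONDITIONAL on rows IV-4c1 (`h1`) and IV-4c3 (`h3`) and on the analytic inputs `hnt` (non-vanishing of member `i`'s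
lift, at the centre line `(a_j)`) and `hK` (transported-equal splittings ⇒ equal `μ_v`): for `E_v` a field, transports `(s_t, M_t)`
of every member with `ω_{s_t}` smooth, `AreIsomorphicRep (quot j) (quot i) → mu j = mu i`.
[cite: Liu2021, App. D Lemma D.1 (3) (l. 5233) and proof l. 5255] [cite: MoeglinVignerasWaldspurger1987, Chap. 3 IV.4]
[cite: Kudla1994, Thm 3.1] -/
theorem mu_eq_of_areIsomorphicRep_nonsplit_of_modelTransport (h1 : rankOne_theta_lines_disjoint)
    (h3 : rankOne_theta_twist_rigidity)
    (hV : TV.IsSymm) (hVd : IsUnit TV.det) (hJV : JV = TV.map (algebraMap F E))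
    (hn : 3 ≤ n) {ι : Type} (aOf : ι → Fˣ) (χOf : ι → Chi F E c)
    (𝓢Of : ∀ i, LocalSplitting.FinLocalSplittings F E c n hcδ hδ hd (gram F e TV (TW F (aOf i))) (isSymm_gram F e hV (isSymm_TW F (aOf i)))
      (reindex_kronecker_eq_gram_map F E e hJV (JW_eq F E (aOf i))))
    (μOf : ι → ∀ v : HeightOneSpectrum (𝓞 F), (LocalRing E v)ˣ →* ℂˣ) (hμn : ∀ i v x, ‖((μOf i v x : ℂˣ) : ℂ)‖ = 1)
    (hμc : ∀ i v, Continuous fun x => ((μOf i v x : ℂˣ) : ℂ))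
    (hμF : ∀ (i : ι) (v : HeightOneSpectrum (𝓞 F)) (t : (v.adicCompletion F)ˣ),
      μOf i v (Units.map (algebraMap (v.adicCompletion F) (LocalRing E v)).toMonoidHom t) = 1 ↔
        ∃ x : (LocalRing E v)ˣ, (x : LocalRing E v) * conjLocal E c v x = algebraMap (v.adicCompletion F) (LocalRing E v) t)
    (v : HeightOneSpectrum (𝓞 F)) (hE : IsField (LocalRing E v)) (i j : ι)
    (δ' : ι → E) (hcδ' : ∀ t, c (δ' t) = -δ' t) (hδ' : ∀ t, δ' t ≠ 0) (d' : ι → F)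
    (hd' : ∀ t, δ' t * δ' t = algebraMap F E (d' t))
    (s : ι → (localPi E c 3 JV v →* LocalMp F 3 TV v))
    (hs : ∀ t g, MpPsi.proj _ (s t g) = iota F E c 3 (hcδ' t) (hδ' t) (hd' t) TV hV hJV v g)
    (hsm : ∀ t, Representation.IsSmooth ((MpPsi.toRep (localSchrodinger F 3 TV v)).comp (s t)))
    (M : ι → (SchwartzBruhat (Fin 3 → v.adicCompletion F) ≃ₗ[ℂ] SchwartzBruhat (Fin n → v.adicCompletion F)))
    (hM : ∀ (t : ι) (g : localPi E c 3 JV v) (Φ : SchwartzBruhat (Fin 3 → v.adicCompletion F)),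
      M t (((MpPsi.toRep (localSchrodinger F 3 TV v)).comp (s t)) g Φ) =
        (show Representation ℂ (localPi E c 3 JV v) (SchwartzBruhat (Fin n → v.adicCompletion F)) from
          ((𝓢Of t).omegaLoc v).comp (localLineInl E c 3 e JV (JW F E (aOf t)) v)) g (M t Φ))
    (hnt : Nontrivial (TwistedCoinv.Coinv
      (show Representation ℂ (localPi E c 1 (JW F E (aOf j)) v) (SchwartzBruhat (Fin 3 → v.adicCompletion F)) from
        ((MpPsi.toRep (localSchrodinger F 3 TV v)).comp (s i)).comp
          (localCenter E c 3 JV (JW F E (aOf j)) (JW_apply_ne_zero F E (aOf j)) v))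
      (localCharOfCenter F E c (JW F E (aOf j)) (JW_apply_ne_zero F E (aOf j)) (χOf i).1 v)))
    (hK : (∃ (x : (LocalRing E v)ˣ) (hx : algebraMap E (LocalRing E v) (δ' j) =
        (x : LocalRing E v) * conjLocal E c v x * algebraMap E (LocalRing E v) (δ' i)),
        lineTransportSplitting E v c 3 (hcδ' i) (hδ' i) (hd' i) (hcδ' j) (hδ' j) (hd' j) x TV hV hVd hx (s i) = s j) →
      μOf j v = μOf i v)
    (hiso : AreIsomorphicRep
      ((localIndexedFamilyAtV F E c 3 e JV hcδ hδ hd hV hVd hJV hn aOf χOf 𝓢Of μOf hμn hμc hμF v).quot j)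
      ((localIndexedFamilyAtV F E c 3 e JV hcδ hδ hd hV hVd hJV hn aOf χOf 𝓢Of μOf hμn hμc hμF v).quot i)) :
    (localIndexedFamilyAtV F E c 3 e JV hcδ hδ hd hV hVd hJV hn aOf χOf 𝓢Of μOf hμn hμc hμF v).mu j =
      (localIndexedFamilyAtV F E c 3 e JV hcδ hδ hd hV hVd hJV hn aOf χOf 𝓢Of μOf hμn hμc hμF v).mu i := by
  have hJh : (JV.map c)ᵀ = JV := transpose_map_conj_JV F E c 3 JV hV hJV
  have hJdet : JV.det ≠ 0 := det_JV_ne_zero F E 3 JV hVd hJV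
  -- unitarity and continuity of the local components `χ_{t,v}` at the line `(a_j)`
  have hχu : ∀ t z, ‖((localCharOfCenter F E c (JW F E (aOf j)) (JW_apply_ne_zero F E (aOf j)) (χOf t).1 v z : ℂˣ) : ℂ)‖ = 1 :=
    fun t => norm_localCharOfCenter F E c (JW F E (aOf j)) (JW_apply_ne_zero F E (aOf j))
      (norm_chi_eq_one F E c (Algebra.IsQuadraticExtension.finrank_eq_two F E)
        (UnitaryGroup.algEquiv_ne_one_of_apply_eq_neg F E c hcδ hδ) (χOf t)) v
  have hχc : ∀ t, Continuous fun z => ((localCharOfCenter F E c (JW F E (aOf j)) (JW_apply_ne_zero F E (aOf j)) (χOf t).1 v z : ℂˣ) : ℂ) :=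
    fun t => continuous_coe_localCharOfCenter F E c (JW F E (aOf j)) (JW_apply_ne_zero F E (aOf j)) (χOf t).2.1 v
  -- (a) both members in the currency of the separation theorem, at the common line `(a_j)`
  have hj := areIsomorphicRep_theta_comp_uEquiv_quot F E c 3 e JV hcδ hδ hd hV hVd hJV hn aOf χOf 𝓢Of μOf hμn hμc hμF v j
    (s j) (M j) (hM j) (JW F E (aOf j)) (JW_apply_ne_zero F E (aOf j))
  have hi := areIsomorphicRep_theta_comp_uEquiv_quot F E c 3 e JV hcδ hδ hd hV hVd hJV hn aOf χOf 𝓢Of μOf hμn hμc hμF v i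
    (s i) (M i) (hM i) (JW F E (aOf j)) (JW_apply_ne_zero F E (aOf j))
  have hisoY := AreIsomorphicRep.of_comp_surjective _
    (LemD1OfPlace.uEquiv E v c 3 JV hcδ hδ (two_le_rank₃'' 3 e hn) hJh hJdet).surjective ((hj.trans hiso).trans hi.symm)
  -- (b) rows IV-4c1 + IV-4c3 at the non-split place: `s_j` is the line transport of `s_i`
  have htr := rankOne_theta_nonsplit_exists_lineTransportSplitting_eq_of_areIsomorphicRep h1 h3 F E c
    (δ' i) (hcδ' i) (hδ' i) (d' i) (hd' i) (δ' j) (hcδ' j) (hδ' j) (d' j) (hd' j) TV hV hVd JV hJV v hE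
    (s i) (s j) (hs i) (hs j) (hsm i) (hsm j)
    (JW F E (aOf j)) (JW_apply_ne_zero F E (aOf j))
    (localCharOfCenter F E c (JW F E (aOf j)) (JW_apply_ne_zero F E (aOf j)) (χOf i).1 v)
    (localCharOfCenter F E c (JW F E (aOf j)) (JW_apply_ne_zero F E (aOf j)) (χOf j).1 v)
    (hχu i) (hχc i) (hχu j) (hχc j) hnt hisoY.symm
  -- (μ) Kudla's local injectivity, transported form
  exact Subtype.ext (hK htr)


/-- **The same AT THE CANONICAL `e′_a` TRANSPORT** (`e = Equiv.prodUnique (Fin 3) (Fin 1)`, `s_t := lineTransportSection … (a_t) …`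
of `LocalLineModelTransport.lean`, `M_t = 1`): the non-vanishing `hnt` is DISCHARGED (MVW IV.2 at the isotropic rank-3 space:
`mvw_IV2_rankOne_nonvanishing_of_isotropic_holds` + `LemD1OfPlace.isIsotropic_standingData_of_three_le`), so the `μ`-clause of
[Liu2021, Lem. D.1 (3)] at a non-split place holds modulo the named facts IV-4c1, IV-4c3 and Kudla's local injectivity `hK` in
transported form — the non-split twin of `mu_and_chi_eq_of_areIsomorphicRep_split_of_facts`.
[cite: Liu2021, App. D Lemma D.1 (3) (l. 5233) and proof l. 5255] [cite: MoeglinVignerasWaldspurger1987, Chap. 3 IV.2, IV.4] -/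
theorem mu_eq_of_areIsomorphicRep_nonsplit_of_facts (h1 : rankOne_theta_lines_disjoint) (h3 : rankOne_theta_twist_rigidity)
    (hV : TV.IsSymm) (hVd : IsUnit TV.det) (hJV : JV = TV.map (algebraMap F E))
    {ι : Type} (aOf : ι → Fˣ) (χOf : ι → Chi F E c)
    (𝓢Of : ∀ i, LocalSplitting.FinLocalSplittings F E c 3 hcδ hδ hd (gram F (Equiv.prodUnique (Fin 3) (Fin 1)) TV (TW F (aOf i)))
      (isSymm_gram F (Equiv.prodUnique (Fin 3) (Fin 1)) hV (isSymm_TW F (aOf i)))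
      (reindex_kronecker_eq_gram_map F E (Equiv.prodUnique (Fin 3) (Fin 1)) hJV (JW_eq F E (aOf i))))
    (μOf : ι → ∀ v : HeightOneSpectrum (𝓞 F), (LocalRing E v)ˣ →* ℂˣ) (hμn : ∀ i v x, ‖((μOf i v x : ℂˣ) : ℂ)‖ = 1)
    (hμc : ∀ i v, Continuous fun x => ((μOf i v x : ℂˣ) : ℂ))
    (hμF : ∀ (i : ι) (v : HeightOneSpectrum (𝓞 F)) (t : (v.adicCompletion F)ˣ),
      μOf i v (Units.map (algebraMap (v.adicCompletion F) (LocalRing E v)).toMonoidHom t) = 1 ↔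
        ∃ x : (LocalRing E v)ˣ, (x : LocalRing E v) * conjLocal E c v x = algebraMap (v.adicCompletion F) (LocalRing E v) t)
    (v : HeightOneSpectrum (𝓞 F)) (hE : IsField (LocalRing E v)) (i j : ι)
    (hK : (∃ (x : (LocalRing E v)ˣ) (hx : algebraMap E (LocalRing E v) (algebraMap F E (↑(aOf j)⁻¹ : F) * δ) =
        (x : LocalRing E v) * conjLocal E c v x * algebraMap E (LocalRing E v) (algebraMap F E (↑(aOf i)⁻¹ : F) * δ)),
        lineTransportSplitting E v c 3 (conj_lineDelta hcδ (aOf i)) (lineDelta_ne_zero hδ (aOf i)) (lineDelta_mul_self hd (aOf i))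
          (conj_lineDelta hcδ (aOf j)) (lineDelta_ne_zero hδ (aOf j)) (lineDelta_mul_self hd (aOf j)) x TV hV hVd hx
          (lineTransportSection F E c 3 hcδ hδ hd TV hV JV hJV (aOf i) v ((𝓢Of i).s v) ((𝓢Of i).proj_s v)) =
        lineTransportSection F E c 3 hcδ hδ hd TV hV JV hJV (aOf j) v ((𝓢Of j).s v) ((𝓢Of j).proj_s v)) →
      μOf j v = μOf i v)
    (hiso : AreIsomorphicRep
      ((localIndexedFamilyAtV F E c 3 (Equiv.prodUnique (Fin 3) (Fin 1)) JV hcδ hδ hd hV hVd hJV (le_refl 3) aOf χOf 𝓢Of μOf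
        hμn hμc hμF v).quot j)
      ((localIndexedFamilyAtV F E c 3 (Equiv.prodUnique (Fin 3) (Fin 1)) JV hcδ hδ hd hV hVd hJV (le_refl 3) aOf χOf 𝓢Of μOf
        hμn hμc hμF v).quot i)) :
    (localIndexedFamilyAtV F E c 3 (Equiv.prodUnique (Fin 3) (Fin 1)) JV hcδ hδ hd hV hVd hJV (le_refl 3) aOf χOf 𝓢Of μOf
        hμn hμc hμF v).mu j =
      (localIndexedFamilyAtV F E c 3 (Equiv.prodUnique (Fin 3) (Fin 1)) JV hcδ hδ hd hV hVd hJV (le_refl 3) aOf χOf 𝓢Of μOf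
        hμn hμc hμF v).mu i := by
  -- the canonical transports: equality of representations `ω_{s_t} = (𝓢_t).omegaLoc v ∘ (k ↦ k ⊗ 1)`
  have H : ∀ t, (MpPsi.toRep (localSchrodinger F 3 TV v)).comp
        (lineTransportSection F E c 3 hcδ hδ hd TV hV JV hJV (aOf t) v ((𝓢Of t).s v) ((𝓢Of t).proj_s v)) =
      (show Representation ℂ (localPi E c 3 JV v) (SchwartzBruhat (Fin 3 → v.adicCompletion F)) from
        ((𝓢Of t).omegaLoc v).comp (localLineInl E c 3 (Equiv.prodUnique (Fin 3) (Fin 1)) JV (JW F E (aOf t)) v)) :=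
    fun t => omega_lineTransportSection_finLocalSplittings F E c 3 hcδ hδ hd TV hV JV hJV (aOf t) v (𝓢Of t)
  have hM : ∀ (t : ι) (g : localPi E c 3 JV v) (Φ : SchwartzBruhat (Fin 3 → v.adicCompletion F)),
      (LinearEquiv.refl ℂ (SchwartzBruhat (Fin 3 → v.adicCompletion F)))
          (((MpPsi.toRep (localSchrodinger F 3 TV v)).comp
            (lineTransportSection F E c 3 hcδ hδ hd TV hV JV hJV (aOf t) v ((𝓢Of t).s v) ((𝓢Of t).proj_s v))) g Φ) =
        (show Representation ℂ (localPi E c 3 JV v) (SchwartzBruhat (Fin 3 → v.adicCompletion F)) from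
          ((𝓢Of t).omegaLoc v).comp (localLineInl E c 3 (Equiv.prodUnique (Fin 3) (Fin 1)) JV (JW F E (aOf t)) v)) g
          ((LinearEquiv.refl ℂ (SchwartzBruhat (Fin 3 → v.adicCompletion F))) Φ) := fun t g Φ => by
    rw [LinearEquiv.refl_apply, LinearEquiv.refl_apply, H t]
  -- non-vanishing of member `i`'s lift at the non-split place (MVW IV.2, proved), read at the centre line `(a_j)`
  have hJh : (JV.map c)ᵀ = JV := transpose_map_conj_JV F E c 3 JV hV hJV
  have hJdet : JV.det ≠ 0 := det_JV_ne_zero F E 3 JV hVd hJV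
  have hχu : ∀ z, ‖((localCharOfCenter F E c (JW F E (aOf j)) (JW_apply_ne_zero F E (aOf j)) (χOf i).1 v z : ℂˣ) : ℂ)‖ = 1 :=
    norm_localCharOfCenter F E c (JW F E (aOf j)) (JW_apply_ne_zero F E (aOf j))
      (norm_chi_eq_one F E c (Algebra.IsQuadraticExtension.finrank_eq_two F E)
        (UnitaryGroup.algEquiv_ne_one_of_apply_eq_neg F E c hcδ hδ) (χOf i)) v
  have hχc : Continuous fun z => ((localCharOfCenter F E c (JW F E (aOf j)) (JW_apply_ne_zero F E (aOf j)) (χOf i).1 v z : ℂˣ) : ℂ) :=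
    continuous_coe_localCharOfCenter F E c (JW F E (aOf j)) (JW_apply_ne_zero F E (aOf j)) (χOf i).2.1 v
  have hnt := mvw_IV2_rankOne_nonvanishing_of_isotropic_holds F E c 3 (algebraMap F E (↑(aOf i)⁻¹ : F) * δ)
    (conj_lineDelta hcδ (aOf i)) (lineDelta_ne_zero hδ (aOf i)) (↑(aOf i)⁻¹ * ↑(aOf i)⁻¹ * d) (lineDelta_mul_self hd (aOf i))
    TV hV hVd JV hJV v hE (by norm_num) hJh hJdet
    (LemD1OfPlace.isIsotropic_standingData_of_three_le E v c 3 JV (conj_lineDelta hcδ (aOf i)) (lineDelta_ne_zero hδ (aOf i))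
      (by norm_num) hJh hJdet le_rfl)
    (lineTransportSection F E c 3 hcδ hδ hd TV hV JV hJV (aOf i) v ((𝓢Of i).s v) ((𝓢Of i).proj_s v))
    (fun g => proj_lineTransportSection F E c 3 hcδ hδ hd TV hV JV hJV (aOf i) v ((𝓢Of i).s v) ((𝓢Of i).proj_s v) g)
    (isSmooth_lineTransportSection F E c 3 hcδ hδ hd TV hV JV hJV (aOf i) v ((𝓢Of i).s v) ((𝓢Of i).proj_s v)
      ((𝓢Of i).smooth v))
    (JW F E (aOf j)) (JW_apply_ne_zero F E (aOf j))
    (localCharOfCenter F E c (JW F E (aOf j)) (JW_apply_ne_zero F E (aOf j)) (χOf i).1 v) hχu hχc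
  exact mu_eq_of_areIsomorphicRep_nonsplit_of_modelTransport F E c hcδ hδ hd (Equiv.prodUnique (Fin 3) (Fin 1)) JV h1 h3
    hV hVd hJV (le_refl 3) aOf χOf 𝓢Of μOf hμn hμc hμF v hE i j
    (fun t => algebraMap F E (↑(aOf t)⁻¹ : F) * δ) (fun t => conj_lineDelta hcδ (aOf t)) (fun t => lineDelta_ne_zero hδ (aOf t))
    (fun t => ↑(aOf t)⁻¹ * ↑(aOf t)⁻¹ * d) (fun t => lineDelta_mul_self hd (aOf t))
    (fun t => lineTransportSection F E c 3 hcδ hδ hd TV hV JV hJV (aOf t) v ((𝓢Of t).s v) ((𝓢Of t).proj_s v))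
    (fun t g => proj_lineTransportSection F E c 3 hcδ hδ hd TV hV JV hJV (aOf t) v ((𝓢Of t).s v) ((𝓢Of t).proj_s v) g)
    (fun t => isSmooth_lineTransportSection F E c 3 hcδ hδ hd TV hV JV hJV (aOf t) v ((𝓢Of t).s v) ((𝓢Of t).proj_s v)
      ((𝓢Of t).smooth v))
    (fun _ => LinearEquiv.refl ℂ _) hM hnt hK hiso

end Three

end Def411WeilCarriers

end Literature.NumberTheory.Automorphic.Liu2021

end
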